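import Mathlib
import Literature.Analysis.FluidPDE.VectorCalculus
import Summits.NavierStokesRegularity.NavierStokesRegularity.Theorems.FilamentSkeletonRssSkeletonEquilibriumSymmetryRigidity

/-!
# `SkeletonEquilibrium` (stmt-NavierStokesRegularity-15400): κ = −1 rigidity for OFFSET symmetry elements (arbitrary translation)

Negative-side structural helper for the (held) support item `FilamentSkeletonRss.SkeletonEquilibrium`
(`--supports stmt-NavierStokesRegularity-15400`); extends `…SymmetryRigidity` (p831234), whose rigidity theorem
assumed the symmetry element passes through the rotation axis (`c₀ = c₁ = 0`), to an ARBITRARY translation part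
`c` of the affine symmetry `x ↦ Mx + c`, `M = diag(s)`: half-turns about ANY horizontal line (with orientation
reversal), mirrors in ANY vertical plane or ANY horizontal plane and inversions about ANY point (orientations
preserved), `R_π` about ANY vertical line (with reversal). The Leray drift `½x` is centred at the origin and the frame
rotation at the axis, so an offset symmetry is not a symmetry of the equation — but the transport identity still closes,
with affine terms, and for `κ = ε det M = −1` it is again a CENTRE LAW `(I − βJ)(Ξ_k τ − p) = λ Ξ_k′ τ`
(`β = α(s₀s₁ + 1)`, `p` the unique solution of a `2 × 2` linear system built from `c`, `s`, `α`). Hence, exactly as in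
p831234: every filament passes through `p` (argmin of `‖Ξ_k − p‖²`), and the separation clause leaves `N ≤ 1`.

* `transport_identity_affine` — the identity with general `c`.
* `centre_law_affine`, `exists_eq_centre_affine`, `subsingleton_affine` — ★ `κ = −1` ⇒ all filaments through the
  centre `p` ⇒ `N ≤ 1`, for every `p` solving `p₀ + βp₁ = −a₀`, `p₁ − βp₀ = −a₁`, `p₂ = −a₂`
  (`a₀ = ½s₀c₀ + αs₀c₁`, `a₁ = ½s₁c₁ − αs₁c₀`, `a₂ = ½s₂c₂`); `exists_centre` — such a `p` exists.

Def-free; Mathlib + `Literature.Analysis.FluidPDE.VectorCalculus` + `…SymmetryRigidity` (`induction_apply_symm`,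
`deriv_apply_symm`).
-/

-- `NavierStokesRegularity.NavierStokesRegularity` is the summit/problem path (D-0017), flagged by dupNamespace.
set_option linter.dupNamespace false

namespace Summit.NavierStokesRegularity.NavierStokesRegularity.Theorems.SkeletonEquilibrium.SymmetryRigidityAffine

open Literature.Analysis.FluidPDE MeasureTheory Filter
open scoped RealInnerProductSpace InnerProductSpace BigOperators Topology
open Summit.NavierStokesRegularity.NavierStokesRegularity.Theorems.SkeletonEquilibrium.SymmetryRigidity
  (induction_apply_symm deriv_apply_symm)

/-- Components of the cross product `v × w`. [folklore] -/
private theorem cross_apply_fin3 (v w : EuclideanSpace ℝ (Fin 3)) :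
    cross v w 0 = v 1 * w 2 - v 2 * w 1 ∧ cross v w 1 = v 2 * w 0 - v 0 * w 2 ∧
      cross v w 2 = v 0 * w 1 - v 1 * w 0 := by
  refine ⟨?_, ?_, ?_⟩ <;> simp [cross, cross_apply]

/-- `⟪eᵢ, v⟫ = v i`. [folklore] -/
private theorem inner_single_left' (i : Fin 3) (v : EuclideanSpace ℝ (Fin 3)) :
    ⟪EuclideanSpace.single i (1 : ℝ), v⟫ = v i := by
  rw [EuclideanSpace.inner_single_left]; simp

/-- Components of the frame rotation `e₃ × v = (−v₁, v₀, 0)`. [folklore] -/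
private theorem cross_e3_apply (v : EuclideanSpace ℝ (Fin 3)) :
    cross (EuclideanSpace.single (2 : Fin 3) (1 : ℝ)) v 0 = -v 1 ∧
      cross (EuclideanSpace.single (2 : Fin 3) (1 : ℝ)) v 1 = v 0 ∧
      cross (EuclideanSpace.single (2 : Fin 3) (1 : ℝ)) v 2 = 0 := by
  obtain ⟨h0, h1, h2⟩ := cross_apply_fin3 (EuclideanSpace.single (2 : Fin 3) (1 : ℝ)) v
  rw [h0, h1, h2]
  refine ⟨?_, ?_, ?_⟩ <;> simp

/-- ‖·‖² of a vector of `ℝ³` in coordinates. [folklore] -/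
private theorem norm_sq_fin3 (v : EuclideanSpace ℝ (Fin 3)) : ‖v‖ ^ 2 = v 0 ^ 2 + v 1 ^ 2 + v 2 ^ 2 := by
  rw [EuclideanSpace.norm_sq_eq]
  simp [Fin.sum_univ_three, Real.norm_eq_abs, sq_abs]

/-- `⟪v, w⟫ = Σ vᵢwᵢ` in `ℝ³`. [folklore] -/
private theorem inner_fin3 (v w : EuclideanSpace ℝ (Fin 3)) : ⟪v, w⟫ = v 0 * w 0 + v 1 * w 1 + v 2 * w 2 := by
  simp only [PiLp.inner_apply, RCLike.inner_apply, conj_trivial, Fin.sum_univ_three]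
  ring

/-- The `2 × 2` system for the centre is always solvable: for all `β, a₀, a₁, a₂` there is `p ∈ ℝ³` with
`p₀ + βp₁ = −a₀`, `p₁ − βp₀ = −a₁`, `p₂ = −a₂`. [folklore] -/
theorem exists_centre (β a₀ a₁ a₂ : ℝ) : ∃ p : EuclideanSpace ℝ (Fin 3),
    p 0 + β * p 1 = -a₀ ∧ p 1 - β * p 0 = -a₁ ∧ p 2 = -a₂ := by
  have hβ : (1 + β ^ 2) ≠ 0 := by positivity
  refine ⟨((-a₀ + β * a₁) / (1 + β ^ 2)) • EuclideanSpace.single (0 : Fin 3) (1 : ℝ) +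
    ((-(β * a₀) - a₁) / (1 + β ^ 2)) • EuclideanSpace.single (1 : Fin 3) (1 : ℝ) +
    (-a₂) • EuclideanSpace.single (2 : Fin 3) (1 : ℝ), ?_, ?_, ?_⟩
  · simp; field_simp; ring
  · simp; field_simp; ring
  · simp

section Affine

variable {N : ℕ} {Ξ : Fin N → ℝ → EuclideanSpace ℝ (Fin 3)} {π : Fin N → Fin N} {s c : Fin 3 → ℝ} {ε : ℝ}
  (hd : ∀ k, Differentiable ℝ (Ξ k)) (hs : ∀ i, s i * s i = 1) (hε : ε * ε = 1)
  (hsym : ∀ k σ i, Ξ (π k) (ε * σ) i = s i * Ξ k σ i + c i)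
  (hπ : ∀ k, π (π k) = k) (γ : Fin N → ℝ) (hγ : ∀ k, γ (π k) = γ k) (Γ α : ℝ) (w : Fin N → ℝ → ℝ)
  (hint : ∀ k (x : EuclideanSpace ℝ (Fin 3)), Integrable (fun σ : ℝ =>
    ((‖x - Ξ k σ‖ ^ 2 + 1) ^ (3 / 2 : ℝ))⁻¹ • cross (deriv (Ξ k) σ) (x - Ξ k σ)))
  (heq : ∀ k τ, (∑ m : Fin N, (Γ * γ m / (4 * Real.pi)) • ∫ σ : ℝ,
      ((‖Ξ k τ - Ξ m σ‖ ^ 2 + 1) ^ (3 / 2 : ℝ))⁻¹ • cross (deriv (Ξ m) σ) (Ξ k τ - Ξ m σ)) +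
      (1 / 2 : ℝ) • Ξ k τ - α • cross (EuclideanSpace.single (2 : Fin 3) (1 : ℝ)) (Ξ k τ) =
      w k τ • deriv (Ξ k) τ)
include hd hs hε hsym hπ hγ hint heq

/-- ★ **Transport identity with arbitrary translation.** For all `k, τ` (`κ = ε s₀s₁s₂`, `y = Ξ_k τ`, `t = Ξ_k′ τ`,
`λ = ε w_{πk}(ετ) − κ w_k τ`):
`(1−κ)·½y₀ + ½s₀c₀ + α(s₀s₁ − κ)y₁ + αs₀c₁ = λt₀`, `(1−κ)·½y₁ + ½s₁c₁ − α(s₀s₁ − κ)y₀ − αs₁c₀ = λt₁`,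
`(1−κ)·½y₂ + ½s₂c₂ = λt₂`. [folklore] -/
theorem transport_identity_affine (k : Fin N) (τ : ℝ) :
    (1 - ε * (s 0 * s 1 * s 2)) * (1 / 2 * Ξ k τ 0) + 1 / 2 * s 0 * c 0 +
        α * (s 0 * s 1 - ε * (s 0 * s 1 * s 2)) * Ξ k τ 1 + α * s 0 * c 1 =
        (ε * w (π k) (ε * τ) - ε * (s 0 * s 1 * s 2) * w k τ) * deriv (Ξ k) τ 0 ∧
      (1 - ε * (s 0 * s 1 * s 2)) * (1 / 2 * Ξ k τ 1) + 1 / 2 * s 1 * c 1 -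
        α * (s 0 * s 1 - ε * (s 0 * s 1 * s 2)) * Ξ k τ 0 - α * s 1 * c 0 =
        (ε * w (π k) (ε * τ) - ε * (s 0 * s 1 * s 2) * w k τ) * deriv (Ξ k) τ 1 ∧
      (1 - ε * (s 0 * s 1 * s 2)) * (1 / 2 * Ξ k τ 2) + 1 / 2 * s 2 * c 2 =
        (ε * w (π k) (ε * τ) - ε * (s 0 * s 1 * s 2) * w k τ) * deriv (Ξ k) τ 2 := by
  have hx' : ∀ i, Ξ (π k) (ε * τ) i = s i * Ξ k τ i + c i := fun i => hsym k τ i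
  have hu := fun i => induction_apply_symm hd hs hε hsym hπ γ hγ Γ hint (Ξ k τ) (Ξ (π k) (ε * τ)) hx' i
  have hT : ∀ j, deriv (Ξ (π k)) (ε * τ) j = ε * s j * deriv (Ξ k) τ j :=
    fun j => deriv_apply_symm hd hε hsym k τ j
  obtain ⟨hJ0, hJ1, hJ2⟩ := cross_e3_apply (Ξ k τ)
  obtain ⟨hJ0', hJ1', hJ2'⟩ := cross_e3_apply (Ξ (π k) (ε * τ))
  have h1 := heq k τ
  have h2 := heq (π k) (ε * τ)
  have c1 := fun i => congrArg (fun v => ⟪EuclideanSpace.single i (1 : ℝ), v⟫) h1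
  have c2 := fun i => congrArg (fun v => ⟪EuclideanSpace.single i (1 : ℝ), v⟫) h2
  have e10 := c1 0
  have e11 := c1 1
  have e12 := c1 2
  have e20 := c2 0
  have e21 := c2 1
  have e22 := c2 2
  simp only [inner_add_right, inner_sub_right, real_inner_smul_right, inner_single_left'] at e10 e11 e12
  simp only [inner_add_right, inner_sub_right, real_inner_smul_right, inner_single_left'] at e20 e21 e22
  rw [hu 0, hJ0', hx' 0, hx' 1, hT 0] at e20
  rw [hu 1, hJ1', hx' 1, hx' 0, hT 1] at e21
  rw [hu 2, hJ2', hx' 2, hT 2] at e22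
  rw [hJ0] at e10
  rw [hJ1] at e11
  rw [hJ2] at e12
  set u0 := (∑ m : Fin N, (Γ * γ m / (4 * Real.pi)) • ∫ σ : ℝ, ((‖Ξ k τ - Ξ m σ‖ ^ 2 + 1) ^ (3 / 2 : ℝ))⁻¹ •
    cross (deriv (Ξ m) σ) (Ξ k τ - Ξ m σ)) 0 with hu0
  set u1 := (∑ m : Fin N, (Γ * γ m / (4 * Real.pi)) • ∫ σ : ℝ, ((‖Ξ k τ - Ξ m σ‖ ^ 2 + 1) ^ (3 / 2 : ℝ))⁻¹ •
    cross (deriv (Ξ m) σ) (Ξ k τ - Ξ m σ)) 1 with hu1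
  set u2 := (∑ m : Fin N, (Γ * γ m / (4 * Real.pi)) • ∫ σ : ℝ, ((‖Ξ k τ - Ξ m σ‖ ^ 2 + 1) ^ (3 / 2 : ℝ))⁻¹ •
    cross (deriv (Ξ m) σ) (Ξ k τ - Ξ m σ)) 2 with hu2
  refine ⟨?_, ?_, ?_⟩
  · linear_combination (s 0) * e20 - (ε * (s 0 * s 1 * s 2)) * e10 +
      (-(1 / 2) * Ξ k τ 0 - ε * (s 0 * s 1 * s 2) * u0 + ε * w (π k) (ε * τ) * deriv (Ξ k) τ 0) * hs 0
  · linear_combination (s 1) * e21 - (ε * (s 0 * s 1 * s 2)) * e11 +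
      (-(1 / 2) * Ξ k τ 1 - ε * (s 0 * s 1 * s 2) * u1 + ε * w (π k) (ε * τ) * deriv (Ξ k) τ 1) * hs 1
  · linear_combination (s 2) * e22 - (ε * (s 0 * s 1 * s 2)) * e12 +
      (-(1 / 2) * Ξ k τ 2 - ε * (s 0 * s 1 * s 2) * u2 + ε * w (π k) (ε * τ) * deriv (Ξ k) τ 2) * hs 2

/-- ★ **Centre law (κ = −1, arbitrary translation).** For every `p` solving the centre system, with `r = Ξ_k τ − p`,
`β = α(s₀s₁ + 1)`, `λ = ε w_{πk}(ετ) + w_k τ`: `r₀ + βr₁ = λt₀`, `r₁ − βr₀ = λt₁`, `r₂ = λt₂`. [folklore] -/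
theorem centre_law_affine (hκ : ε * (s 0 * s 1 * s 2) = -1) (p : EuclideanSpace ℝ (Fin 3))
    (hp : p 0 + α * (s 0 * s 1 + 1) * p 1 = -(1 / 2 * s 0 * c 0 + α * s 0 * c 1) ∧
      p 1 - α * (s 0 * s 1 + 1) * p 0 = -(1 / 2 * s 1 * c 1 - α * s 1 * c 0) ∧ p 2 = -(1 / 2 * s 2 * c 2))
    (k : Fin N) (τ : ℝ) :
    (Ξ k τ 0 - p 0) + α * (s 0 * s 1 + 1) * (Ξ k τ 1 - p 1) =
        (ε * w (π k) (ε * τ) + w k τ) * deriv (Ξ k) τ 0 ∧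
      (Ξ k τ 1 - p 1) - α * (s 0 * s 1 + 1) * (Ξ k τ 0 - p 0) =
        (ε * w (π k) (ε * τ) + w k τ) * deriv (Ξ k) τ 1 ∧
      (Ξ k τ 2 - p 2) = (ε * w (π k) (ε * τ) + w k τ) * deriv (Ξ k) τ 2 := by
  obtain ⟨h0, h1, h2⟩ := transport_identity_affine hd hs hε hsym hπ γ hγ Γ α w hint heq k τ
  rw [hκ] at h0 h1 h2
  obtain ⟨hp0, hp1, hp2⟩ := hp
  refine ⟨?_, ?_, ?_⟩
  · linear_combination h0 - hp0
  · linear_combination h1 - hp1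
  · linear_combination h2 - hp2

/-- ★ **Every filament passes through the centre** (κ = −1, arbitrary translation, proper filaments). [folklore] -/
theorem exists_eq_centre_affine (hκ : ε * (s 0 * s 1 * s 2) = -1) (p : EuclideanSpace ℝ (Fin 3))
    (hp : p 0 + α * (s 0 * s 1 + 1) * p 1 = -(1 / 2 * s 0 * c 0 + α * s 0 * c 1) ∧
      p 1 - α * (s 0 * s 1 + 1) * p 0 = -(1 / 2 * s 1 * c 1 - α * s 1 * c 0) ∧ p 2 = -(1 / 2 * s 2 * c 2))
    (hprop : ∀ k, Tendsto (fun τ => ‖Ξ k τ‖) atTop atTop ∧ Tendsto (fun τ => ‖Ξ k τ‖) atBot atTop)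
    (k : Fin N) : ∃ τ, Ξ k τ = p := by
  set r : ℝ → EuclideanSpace ℝ (Fin 3) := fun τ => Ξ k τ - p with hr
  set g : ℝ → ℝ := fun τ => ⟪r τ, r τ⟫ with hg
  have hrc : Continuous r := (hd k).continuous.sub continuous_const
  have hgc : Continuous g := hrc.inner hrc
  have hnorm_tend : ∀ {l : Filter ℝ}, Tendsto (fun τ => ‖Ξ k τ‖) l atTop → Tendsto g l atTop := by
    intro l hl
    have h1 : Tendsto (fun τ => ‖Ξ k τ‖ - ‖p‖) l atTop := tendsto_atTop_add_const_right _ _ hl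
    have h2 : Tendsto (fun τ => ‖r τ‖) l atTop :=
      tendsto_atTop_mono (fun τ => by simpa [hr] using norm_sub_norm_le (Ξ k τ) p) h1
    have h3 : Tendsto (fun τ => ‖r τ‖ ^ 2) l atTop := (tendsto_pow_atTop two_ne_zero).comp h2
    refine h3.congr fun τ => ?_
    simp [hg]
  have hlim : Tendsto g (cocompact ℝ) atTop := by
    rw [cocompact_eq_atBot_atTop]
    exact (hnorm_tend (hprop k).2).sup (hnorm_tend (hprop k).1)
  obtain ⟨τm, hτm⟩ := hgc.exists_forall_le hlim
  have hrd : HasDerivAt r (deriv (Ξ k) τm) τm := by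
    simpa [hr] using ((hd k τm).hasDerivAt).sub_const p
  have hgd : HasDerivAt g (⟪r τm, deriv (Ξ k) τm⟫ + ⟪deriv (Ξ k) τm, r τm⟫) τm := hrd.inner ℝ hrd
  have hmin : IsLocalMin g τm := Eventually.of_forall fun y => hτm y
  have hzero := hmin.hasDerivAt_eq_zero hgd
  have hcomm : ⟪r τm, deriv (Ξ k) τm⟫ = ⟪deriv (Ξ k) τm, r τm⟫ := real_inner_comm _ _
  have hinner0 : ⟪r τm, deriv (Ξ k) τm⟫ = 0 := by linarith
  obtain ⟨h0, h1, h2⟩ := centre_law_affine hd hs hε hsym hπ γ hγ Γ α w hint heq hκ p hp k τm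
  have hr0 : r τm 0 = Ξ k τm 0 - p 0 := by simp only [hr, PiLp.sub_apply]
  have hr1 : r τm 1 = Ξ k τm 1 - p 1 := by simp only [hr, PiLp.sub_apply]
  have hr2 : r τm 2 = Ξ k τm 2 - p 2 := by simp only [hr, PiLp.sub_apply]
  have hsq : ‖r τm‖ ^ 2 = (ε * w (π k) (ε * τm) + w k τm) * ⟪r τm, deriv (Ξ k) τm⟫ := by
    rw [norm_sq_fin3, inner_fin3, hr0, hr1, hr2]
    linear_combination (Ξ k τm 0 - p 0) * h0 + (Ξ k τm 1 - p 1) * h1 + (Ξ k τm 2 - p 2) * h2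
  rw [hinner0, mul_zero] at hsq
  have : r τm = 0 := by
    have := pow_eq_zero_iff (n := 2) (by norm_num) |>.mp hsq
    exact norm_eq_zero.mp this
  exact ⟨τm, by simpa [hr, sub_eq_zero] using this⟩

/-- ★ **κ = −1 rigidity for offset symmetry elements**: with the separation clause, `N ≤ 1` (as
`∀ k m, k = m`). Covers half-turns about any horizontal line with reversal, mirrors in any vertical plane /
horizontal plane and inversions about any point with orientations preserved, `R_π` about any vertical line with
reversal. [folklore] -/
theorem subsingleton_affine (hκ : ε * (s 0 * s 1 * s 2) = -1) (d : ℝ) (hdpos : 0 < d)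
    (hprop : ∀ k, Tendsto (fun τ => ‖Ξ k τ‖) atTop atTop ∧ Tendsto (fun τ => ‖Ξ k τ‖) atBot atTop)
    (hsep : ∀ k m, k ≠ m → ∀ τ σ, d ≤ ‖Ξ k τ - Ξ m σ‖) : ∀ k m : Fin N, k = m := by
  obtain ⟨p, hp⟩ := exists_centre (α * (s 0 * s 1 + 1)) (1 / 2 * s 0 * c 0 + α * s 0 * c 1)
    (1 / 2 * s 1 * c 1 - α * s 1 * c 0) (1 / 2 * s 2 * c 2)
  intro k m
  by_contra hkm
  obtain ⟨τ, hτ⟩ := exists_eq_centre_affine hd hs hε hsym hπ γ hγ Γ α w hint heq hκ p hp hprop k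
  obtain ⟨σ, hσ⟩ := exists_eq_centre_affine hd hs hε hsym hπ γ hγ Γ α w hint heq hκ p hp hprop m
  have h := hsep k m hkm τ σ
  rw [hτ, hσ, sub_self, norm_zero] at h
  linarith

end Affine

end Summit.NavierStokesRegularity.NavierStokesRegularity.Theorems.SkeletonEquilibrium.SymmetryRigidityAffine
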